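import Mathlib
import Literature.Analysis.FluidPDE.QuasiStaticSlotWeight
import Summits.AnomalousDissipation.AnomalousDissipation.Theorems.SolenoidalFractalHomogenisationLagrangianStepW7EngineSpine

/-!
# W7 · ENGINE §1′ — the ramped-slot Grönwall for ABSOLUTELY CONTINUOUS functionals (a.e. derivative), and the Lipschitz envelope

planner ad-ideate-p5 g10 (lens «profile»), 2026-08-28 — addendum to `Lines/onelevel_W7_engine.lean` (d2cfba26e719; §1–§3 landed verbatim as
`Theorems/SolenoidalFractalHomogenisationLagrangianStepW7EngineSpine.lean`, p670272), written at the request of the S1a owner (prover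
ad-k1l-cellLawV-w1 g4, STATUS 21:35:05Z) and p4 g13 (21:35:38Z (iv)): a weak solution of the cell problem delivers its mode coefficients / energy only as
ABSOLUTELY CONTINUOUS functions of time with an a.e. derivative (Lebesgue differentiation), never an everywhere (right-)derivative.  So the per-slot
contraction of the spine is restated here in exactly that regularity:

* `gronwall_ac_exp` — `Φ` absolutely continuous on `[t₀, t₁]`, `HasDerivAt Φ (φ t) t` for a.e. `t ∈ (t₀, t₁)`, `σ` merely INTERVAL-INTEGRABLE (any sign;
  the kinks of the trapezoid envelope are invisible), `φ ≤ −σ·Φ` a.e. ⇒ `Φ t₁ ≤ exp(−∫_{t₀}^{t₁} σ)·Φ t₀`.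
  Proof: the integrating factor `G = exp(∫_{t₀}^· σ)·Φ` is absolutely continuous (`exp` is Lipschitz on the bounded range of the AC primitive —
  `absolutelyContinuousOnInterval_comp_of_lipschitzOnWith`, `lipschitzOnWith_exp_Iic`; product by `AbsolutelyContinuousOnInterval.fun_mul`), its a.e.
  derivative is `exp(∫σ)(σΦ + φ) ≤ 0` (Lebesgue differentiation `IntervalIntegrable.ae_hasDerivAt_integral`, `HasDerivAt.exp/.mul`), and the FTC for AC
  functions (`AbsolutelyContinuousOnInterval.integral_deriv_eq_sub`) with `intervalIntegral.integral_mono_ae_restrict` gives `G t₁ ≤ G t₀`.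
* `slot_contraction_ac` / `slot_contraction_ac_of_nonneg` — the packaged per-slot statements of the spine (`rate_transfer` from the landed spine) with
  the hypotheses in S1a's shape: sandwich `c₁E ≤ Φ ≤ c₂E` a.e. on `(t₀, t₁)`, `φ ≤ −ρ·E` a.e., `ρ` interval-integrable, `Φ = E` at the two slot ends ⇒
  `E t₁ ≤ exp(−∫ min(ρ/c₂, ρ/c₁))·E t₀` (resp. `exp(−(1/c₂)∫ρ)` for `ρ ≥ 0` a.e.).
* §4′ `lipschitzWith_trapezoid` — the slot envelope `LatticeWord.trapezoid a τ ρ` is `1/(ρτ)`-Lipschitz (hence AC on every interval,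
  `absolutelyContinuousOnInterval_trapezoid`, a.e. differentiable with `|deriv| ≤ 1/(ρτ)` everywhere, `abs_deriv_trapezoid_le`), plus the two-sided
  derivatives on the three open pieces (`hasDerivAt_trapezoid_of_mem_rampUp/plateau/rampDown`).  For the cubature word (`ρ = 1/2`, the triangle) the
  crude bound `∫₀^τ (deriv)² ≤ τ/(ρτ)² = 4/τ` is the exact value, so nothing is lost by using only the Lipschitz constant.

0 sorry.  Imports: Mathlib, `Literature.Analysis.FluidPDE.QuasiStaticSlotWeight` (trapezoid piece formulas), the landed spine (for `rate_transfer`).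
-/

set_option linter.dupNamespace false
set_option linter.unusedVariables false

open MeasureTheory Set Filter Topology intervalIntegral
open scoped Interval NNReal

namespace Summit.AnomalousDissipation.AnomalousDissipation.Cruxes.LagrangianRenormalisationStep.W7EngineAC

open Summit.AnomalousDissipation.AnomalousDissipation.Theorems.SolenoidalFractalHomogenisation.LagrangianStep.W7Engine
  (rate_transfer min_div_eq_pos_sub_neg)

/-! ## §1′a  Absolute continuity of `exp ∘ (AC primitive)` -/

/-- Composition of an absolutely continuous function with a function that is Lipschitz ON A SET containing its range over the
interval is absolutely continuous (the `LipschitzOnWith` form of the folklore composition lemma). -/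
theorem absolutelyContinuousOnInterval_comp_of_lipschitzOnWith {X Y : Type*} [PseudoMetricSpace X] [PseudoMetricSpace Y]
    {P : ℝ → X} {a b : ℝ} (hP : AbsolutelyContinuousOnInterval P a b)
    {g : X → Y} {K : ℝ≥0} {S : Set X} (hg : LipschitzOnWith K g S) (hmaps : MapsTo P (uIcc a b) S) :
    AbsolutelyContinuousOnInterval (g ∘ P) a b := by
  rw [absolutelyContinuousOnInterval_iff] at hP ⊢
  intro ε hε
  obtain ⟨δ, hδ, hPδ⟩ := hP (ε / (K + 1)) (by positivity)
  refine ⟨δ, hδ, fun E hE hlen => ?_⟩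
  have hK : (0 : ℝ) ≤ K := K.2
  calc ∑ i ∈ Finset.range E.1, dist ((g ∘ P) (E.2 i).1) ((g ∘ P) (E.2 i).2)
      ≤ ∑ i ∈ Finset.range E.1, K * dist (P (E.2 i).1) (P (E.2 i).2) :=
        Finset.sum_le_sum fun i hi => hg.dist_le_mul _ (hmaps (hE.1 i hi).1) _ (hmaps (hE.1 i hi).2)
    _ = K * ∑ i ∈ Finset.range E.1, dist (P (E.2 i).1) (P (E.2 i).2) := (Finset.mul_sum _ _ _).symm
    _ ≤ K * (ε / (K + 1)) := mul_le_mul_of_nonneg_left (hPδ E hE hlen).le hK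
    _ < (K + 1) * (ε / (K + 1)) := by gcongr; linarith
    _ = ε := by field_simp

/-- `exp` is `exp C`-Lipschitz on `(-∞, C]`. -/
theorem lipschitzOnWith_exp_Iic (C : ℝ) : LipschitzOnWith (Real.exp C).toNNReal Real.exp (Iic C) := by
  refine (convex_Iic C).lipschitzOnWith_of_nnnorm_deriv_le (𝕜 := ℝ) (fun x _ => Real.differentiableAt_exp) ?_
  intro x hx
  rw [Real.deriv_exp, ← NNReal.coe_le_coe, coe_nnnorm, Real.norm_eq_abs, abs_of_pos (Real.exp_pos x),
    Real.coe_toNNReal _ (Real.exp_pos C).le]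
  exact Real.exp_le_exp.2 hx

/-- `exp` of an absolutely continuous real function is absolutely continuous on the same interval. -/
theorem absolutelyContinuousOnInterval_exp_comp {P : ℝ → ℝ} {a b : ℝ} (hP : AbsolutelyContinuousOnInterval P a b) :
    AbsolutelyContinuousOnInterval (fun t => Real.exp (P t)) a b := by
  obtain ⟨C, hC⟩ := hP.exists_bound
  have hmaps : MapsTo P (uIcc a b) (Iic C) := fun t ht =>
    (le_abs_self _).trans ((Real.norm_eq_abs _).symm.trans_le (hC t ht))
  exact absolutelyContinuousOnInterval_comp_of_lipschitzOnWith hP (lipschitzOnWith_exp_Iic C) hmaps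

/-! ## §1′b  Variable-rate Grönwall for AC functions with an a.e. derivative -/

/-- **Grönwall, absolutely continuous form.**  `Φ` AC on `[t₀, t₁]`, `Φ' = φ` a.e. on `(t₀, t₁)`, `σ` interval-integrable (any sign),
`φ ≤ −σ Φ` a.e. on `(t₀, t₁)` ⇒ `Φ t₁ ≤ exp(−∫_{t₀}^{t₁} σ)·Φ t₀`. -/
theorem gronwall_ac_exp {Φ φ σ : ℝ → ℝ} {t₀ t₁ : ℝ} (ht : t₀ ≤ t₁)
    (hΦ : AbsolutelyContinuousOnInterval Φ t₀ t₁)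
    (hΦd : ∀ᵐ t, t ∈ Ioo t₀ t₁ → HasDerivAt Φ (φ t) t)
    (hσ : IntervalIntegrable σ volume t₀ t₁)
    (hineq : ∀ᵐ t, t ∈ Ioo t₀ t₁ → φ t ≤ -σ t * Φ t) :
    Φ t₁ ≤ Real.exp (-∫ s in t₀..t₁, σ s) * Φ t₀ := by
  have hIcc : uIcc t₀ t₁ = Icc t₀ t₁ := uIcc_of_le ht
  -- the integrating factor `exp (P t)`, `P t = ∫_{t₀}^t σ`
  set P : ℝ → ℝ := fun t => ∫ s in t₀..t, σ s with hPdef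
  have hPac : AbsolutelyContinuousOnInterval P t₀ t₁ :=
    hσ.absolutelyContinuousOnInterval_intervalIntegral (c := t₀) (by simp)
  have hPd : ∀ᵐ t, t ∈ Ioo t₀ t₁ → HasDerivAt P (σ t) t := by
    filter_upwards [hσ.ae_hasDerivAt_integral] with t h htI
    exact h (hIcc ▸ Ioo_subset_Icc_self htI) t₀ (by simp)
  set G : ℝ → ℝ := fun t => Real.exp (P t) * Φ t with hGdef
  have hGac : AbsolutelyContinuousOnInterval G t₀ t₁ :=
    (absolutelyContinuousOnInterval_exp_comp hPac).fun_mul hΦ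
  -- a.e. derivative of `G` and its sign
  have hderiv_nonpos : ∀ᵐ t, t ∈ Ioo t₀ t₁ → deriv G t ≤ 0 := by
    filter_upwards [hPd, hΦd, hineq] with t hP' hΦ' hin htI
    have hG : HasDerivAt G (Real.exp (P t) * σ t * Φ t + Real.exp (P t) * φ t) t := by
      have h := ((hP' htI).exp).fun_mul (hΦ' htI)
      rw [hGdef]
      convert h using 1
    rw [hG.deriv]
    have hexp : 0 < Real.exp (P t) := Real.exp_pos _
    have h1 := hin htI
    have : Real.exp (P t) * (σ t * Φ t + φ t) ≤ 0 :=
      mul_nonpos_of_nonneg_of_nonpos hexp.le (by linarith)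
    linarith [this]
  -- FTC for AC functions + monotonicity of the integral
  have hftc := hGac.integral_deriv_eq_sub
  have hle : ∫ t in t₀..t₁, deriv G t ≤ ∫ t in t₀..t₁, (fun _ => (0:ℝ)) t := by
    refine intervalIntegral.integral_mono_ae_restrict ht hGac.intervalIntegrable_deriv intervalIntegrable_const ?_
    rw [Filter.EventuallyLE, ae_restrict_iff' measurableSet_Icc]
    have hnull : ∀ᵐ t : ℝ, t ∉ ({t₀, t₁} : Set ℝ) :=
      measure_eq_zero_iff_ae_notMem.1 ((Set.toFinite {t₀, t₁}).measure_zero volume)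
    filter_upwards [hderiv_nonpos, hnull] with t h hne htI
    have : t ∈ Ioo t₀ t₁ := by
      simp only [mem_insert_iff, mem_singleton_iff, not_or] at hne
      exact ⟨lt_of_le_of_ne htI.1 (Ne.symm hne.1), lt_of_le_of_ne htI.2 hne.2⟩
    exact h this
  rw [intervalIntegral.integral_const, smul_zero, hftc] at hle
  have hP0 : P t₀ = 0 := by simp [hPdef]
  have hG0 : G t₀ = Φ t₀ := by simp [hGdef, hP0]
  have hG1 : G t₁ = Real.exp (P t₁) * Φ t₁ := rfl
  have hkey : Real.exp (P t₁) * Φ t₁ ≤ Φ t₀ := by linarith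
  have hexp1 : 0 < Real.exp (-P t₁) := Real.exp_pos _
  calc Φ t₁ = Real.exp (-P t₁) * (Real.exp (P t₁) * Φ t₁) := by
          rw [← mul_assoc, ← Real.exp_add]; simp
    _ ≤ Real.exp (-P t₁) * Φ t₀ := mul_le_mul_of_nonneg_left hkey hexp1.le
    _ = Real.exp (-∫ s in t₀..t₁, σ s) * Φ t₀ := rfl

/-- Interval-integrability of the signed rate `min (ρ/c₂) (ρ/c₁)`. -/
theorem intervalIntegrable_min_div {ρ : ℝ → ℝ} {t₀ t₁ : ℝ} (c₁ c₂ : ℝ) (hρ : IntervalIntegrable ρ volume t₀ t₁) :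
    IntervalIntegrable (fun s => min (ρ s / c₂) (ρ s / c₁)) volume t₀ t₁ := by
  have h1 := hρ.div_const c₂
  have h2 := hρ.div_const c₁
  exact ⟨h1.1.inf h2.1, h1.2.inf h2.2⟩

/-- **Per-slot contraction, AC form** (the spine's `slot_contraction` in the regularity a weak solution delivers).  On the slot `[t₀, t₁]`:
`Φ` AC with a.e. derivative `φ`, `φ ≤ −ρ·E` a.e. (`ρ` interval-integrable, any sign), the sandwich `c₁E ≤ Φ ≤ c₂E` a.e. (`0 < c₁ ≤ c₂`) and
`Φ = E` at the two slot ends (ramped envelope) ⇒ `E t₁ ≤ exp(−∫ min(ρ/c₂, ρ/c₁))·E t₀`, no prefactor. -/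
theorem slot_contraction_ac {E Φ φ ρ : ℝ → ℝ} {t₀ t₁ c₁ c₂ : ℝ} (ht : t₀ ≤ t₁) (hc₁ : 0 < c₁) (hc₁₂ : c₁ ≤ c₂)
    (hΦ : AbsolutelyContinuousOnInterval Φ t₀ t₁)
    (hΦd : ∀ᵐ t, t ∈ Ioo t₀ t₁ → HasDerivAt Φ (φ t) t)
    (hρ : IntervalIntegrable ρ volume t₀ t₁)
    (hineq : ∀ᵐ t, t ∈ Ioo t₀ t₁ → φ t ≤ -ρ t * E t)
    (hsand : ∀ᵐ t, t ∈ Ioo t₀ t₁ → c₁ * E t ≤ Φ t ∧ Φ t ≤ c₂ * E t)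
    (h₀ : Φ t₀ = E t₀) (h₁ : Φ t₁ = E t₁) :
    E t₁ ≤ Real.exp (-∫ s in t₀..t₁, min (ρ s / c₂) (ρ s / c₁)) * E t₀ := by
  have hineq' : ∀ᵐ t, t ∈ Ioo t₀ t₁ → φ t ≤ -(min (ρ t / c₂) (ρ t / c₁)) * Φ t := by
    filter_upwards [hineq, hsand] with t hin hs htI
    exact rate_transfer hc₁ hc₁₂ (hs htI).1 (hs htI).2 (hin htI)
  have h := gronwall_ac_exp ht hΦ hΦd (intervalIntegrable_min_div c₁ c₂ hρ) hineq'
  rw [h₀, h₁] at h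
  exact h

/-- The `ρ ≥ 0` a.e. form: contraction by `exp(−(1/c₂)∫ρ)`. -/
theorem slot_contraction_ac_of_nonneg {E Φ φ ρ : ℝ → ℝ} {t₀ t₁ c₁ c₂ : ℝ} (ht : t₀ ≤ t₁) (hc₁ : 0 < c₁) (hc₁₂ : c₁ ≤ c₂)
    (hΦ : AbsolutelyContinuousOnInterval Φ t₀ t₁)
    (hΦd : ∀ᵐ t, t ∈ Ioo t₀ t₁ → HasDerivAt Φ (φ t) t)
    (hρ : IntervalIntegrable ρ volume t₀ t₁) (hρ0 : ∀ᵐ t, t ∈ Ioo t₀ t₁ → 0 ≤ ρ t)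
    (hineq : ∀ᵐ t, t ∈ Ioo t₀ t₁ → φ t ≤ -ρ t * E t)
    (hsand : ∀ᵐ t, t ∈ Ioo t₀ t₁ → c₁ * E t ≤ Φ t ∧ Φ t ≤ c₂ * E t)
    (h₀ : Φ t₀ = E t₀) (h₁ : Φ t₁ = E t₁) :
    E t₁ ≤ Real.exp (-((1 / c₂) * ∫ s in t₀..t₁, ρ s)) * E t₀ := by
  have h := slot_contraction_ac ht hc₁ hc₁₂ hΦ hΦd hρ hineq hsand h₀ h₁
  have hc₂ : 0 < c₂ := lt_of_lt_of_le hc₁ hc₁₂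
  have hint : ∫ s in t₀..t₁, min (ρ s / c₂) (ρ s / c₁) = (1 / c₂) * ∫ s in t₀..t₁, ρ s := by
    rw [← intervalIntegral.integral_const_mul]
    refine intervalIntegral.integral_congr_ae ?_
    have hnull : ∀ᵐ t : ℝ, t ∉ ({t₀, t₁} : Set ℝ) :=
      measure_eq_zero_iff_ae_notMem.1 ((Set.toFinite {t₀, t₁}).measure_zero volume)
    filter_upwards [hρ0, hnull] with t h hne htI
    rw [uIoc_of_le ht] at htI
    have htI' : t ∈ Ioo t₀ t₁ := by
      simp only [mem_insert_iff, mem_singleton_iff, not_or] at hne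
      exact ⟨htI.1, lt_of_le_of_ne htI.2 hne.2⟩
    have hρt := h htI'
    rw [min_eq_left (div_le_div_of_nonneg_left hρt hc₁ hc₁₂)]
    ring
  rw [hint] at h
  exact h

/-! ## §4′  The slot envelope is Lipschitz (hence AC, a.e. differentiable, `|deriv| ≤ 1/(ρτ)`) -/

section Envelope
open Literature.Analysis.FluidPDE Literature.Analysis.FluidPDE.LatticeShear

/-- The trapezoid envelope with ramps of length `ρτ` is `1/(ρτ)`-Lipschitz. -/
theorem lipschitzWith_trapezoid (a : ℝ) {τ ρ : ℝ} (hτ : 0 < τ) (hρ : 0 < ρ) :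
    LipschitzWith (Real.toNNReal (1 / (ρ * τ))) (fun s => LatticeWord.trapezoid a τ ρ s) := by
  have hρτ : (0:ℝ) < ρ * τ := mul_pos hρ hτ
  have hK : ((Real.toNNReal (1 / (ρ * τ)) : ℝ≥0) : ℝ) = 1 / (ρ * τ) := Real.coe_toNNReal _ (by positivity)
  have h1 : LipschitzWith (Real.toNNReal (1 / (ρ * τ))) (fun s : ℝ => (s - a) / (ρ * τ)) := by
    refine LipschitzWith.of_dist_le_mul fun x y => ?_
    rw [hK, Real.dist_eq, Real.dist_eq, ← sub_div, abs_div, abs_of_pos hρτ]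
    have : x - a - (y - a) = x - y := by ring
    rw [this]
    exact le_of_eq (by field_simp)
  have h2 : LipschitzWith (Real.toNNReal (1 / (ρ * τ))) (fun s : ℝ => (a + τ - s) / (ρ * τ)) := by
    refine LipschitzWith.of_dist_le_mul fun x y => ?_
    rw [hK, Real.dist_eq, Real.dist_eq, ← sub_div, abs_div, abs_of_pos hρτ]
    have : a + τ - x - (a + τ - y) = -(x - y) := by ring
    rw [this, abs_neg]
    exact le_of_eq (by field_simp)
  have h3 := h1.min h2
  rw [max_self] at h3
  have h4 := (h3.const_min 1).const_max 0
  refine LipschitzWith.of_dist_le_mul fun x y => ?_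
  simp only [LatticeWord.trapezoid]
  exact h4.dist_le_mul x y

/-- Hence the envelope is absolutely continuous on every interval. -/
theorem absolutelyContinuousOnInterval_trapezoid (a : ℝ) {τ ρ : ℝ} (hτ : 0 < τ) (hρ : 0 < ρ) (t₀ t₁ : ℝ) :
    AbsolutelyContinuousOnInterval (fun s => LatticeWord.trapezoid a τ ρ s) t₀ t₁ :=
  ((lipschitzWith_trapezoid a hτ hρ).lipschitzOnWith).absolutelyContinuousOnInterval

/-- … with `|deriv| ≤ 1/(ρτ)` EVERYWHERE (`deriv = 0` at the kinks by convention). -/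
theorem abs_deriv_trapezoid_le (a : ℝ) {τ ρ : ℝ} (hτ : 0 < τ) (hρ : 0 < ρ) (s : ℝ) :
    |deriv (fun x => LatticeWord.trapezoid a τ ρ x) s| ≤ 1 / (ρ * τ) := by
  have h := norm_deriv_le_of_lipschitz (𝕜 := ℝ) (x₀ := s) (lipschitzWith_trapezoid a hτ hρ)
  rw [Real.norm_eq_abs, Real.coe_toNNReal _ (by positivity)] at h
  exact h

/-- … and differentiable a.e. on every interval, with derivative `deriv`. -/
theorem ae_hasDerivAt_trapezoid (a : ℝ) {τ ρ : ℝ} (hτ : 0 < τ) (hρ : 0 < ρ) (t₀ t₁ : ℝ) :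
    ∀ᵐ s, s ∈ uIcc t₀ t₁ → HasDerivAt (fun x => LatticeWord.trapezoid a τ ρ x)
      (deriv (fun x => LatticeWord.trapezoid a τ ρ x) s) s := by
  filter_upwards [(absolutelyContinuousOnInterval_trapezoid a hτ hρ t₀ t₁).ae_differentiableAt] with s hs hsI
  exact (hs hsI).hasDerivAt

/-- Two-sided derivative on the up-ramp `(0, ρτ)`: slope `1/(ρτ)`. -/
theorem hasDerivAt_trapezoid_of_mem_rampUp {τ ρ s : ℝ} (hτ : 0 < τ) (hρ : 0 < ρ) (hρ2 : ρ ≤ 1 / 2)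
    (hs : s ∈ Ioo 0 (ρ * τ)) :
    HasDerivAt (fun x => LatticeWord.trapezoid 0 τ ρ x) (1 / (ρ * τ)) s := by
  have hg : HasDerivAt (fun x : ℝ => x / (ρ * τ)) (1 / (ρ * τ)) s := (hasDerivAt_id s).div_const (ρ * τ)
  refine hg.congr_of_eventuallyEq ?_
  filter_upwards [Ioo_mem_nhds hs.1 hs.2] with x hx
  exact trapezoid_eq_of_mem_ramp_up hτ hρ hρ2 ⟨hx.1.le, hx.2.le⟩

/-- Two-sided derivative on the plateau `(ρτ, τ − ρτ)`: slope `0`. -/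
theorem hasDerivAt_trapezoid_of_mem_plateau {τ ρ s : ℝ} (hτ : 0 < τ) (hρ : 0 < ρ) (hρ2 : ρ ≤ 1 / 2)
    (hs : s ∈ Ioo (ρ * τ) (τ - ρ * τ)) :
    HasDerivAt (fun x => LatticeWord.trapezoid 0 τ ρ x) 0 s := by
  refine (hasDerivAt_const s (1:ℝ)).congr_of_eventuallyEq ?_
  filter_upwards [Ioo_mem_nhds hs.1 hs.2] with x hx
  exact trapezoid_eq_of_mem_plateau hτ hρ ⟨hx.1.le, hx.2.le⟩

/-- Two-sided derivative on the down-ramp `(τ − ρτ, τ)`: slope `−1/(ρτ)`. -/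
theorem hasDerivAt_trapezoid_of_mem_rampDown {τ ρ s : ℝ} (hτ : 0 < τ) (hρ : 0 < ρ) (hρ2 : ρ ≤ 1 / 2)
    (hs : s ∈ Ioo (τ - ρ * τ) τ) :
    HasDerivAt (fun x => LatticeWord.trapezoid 0 τ ρ x) (-(1 / (ρ * τ))) s := by
  have hg : HasDerivAt (fun x : ℝ => (τ - x) / (ρ * τ)) ((0 - 1) / (ρ * τ)) s :=
    ((hasDerivAt_const s τ).sub (hasDerivAt_id s)).div_const (ρ * τ)
  have he : (0 - 1) / (ρ * τ) = -(1 / (ρ * τ)) := by ring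
  rw [he] at hg
  refine hg.congr_of_eventuallyEq ?_
  filter_upwards [Ioo_mem_nhds hs.1 hs.2] with x hx
  exact trapezoid_eq_of_mem_ramp_down hτ hρ hρ2 ⟨hx.1.le, hx.2.le⟩

end Envelope

end Summit.AnomalousDissipation.AnomalousDissipation.Cruxes.LagrangianRenormalisationStep.W7EngineAC
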